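import Literature.NumberTheory.DiophantineGeometry.GenEllRadicalCoverDifferent
import Mathlib.FieldTheory.PolynomialGaloisGroup
import HarnessLib

/-!
# [GenEll] Prop. 1.7 (i), right inequality, for the Kummer covers of `ℙ¹ ∖ {0,1,∞}`:
# the log-different of `K(a^{1/e})`

S. Mochizuki, *Arithmetic elliptic curves in general position*, Math. J. Okayama Univ. 52 (2010)
[cite: MochizukiGenEll2010, Prop 1.7 (i) p.9], Prop. 1.7 (i) pp. 9–10 (right inequality
`log-diff_Y − log-diff_Z ≲ (1 − 1/e)·log-cond_E`), in the case the proof of Thm. 2.1 (p. 11: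
"there exists a connected finite étale Galois covering `U_Y → U_X`, such that … `Y → X` is ramified at
each point of `E` with ramification index equal to `e`") uses it for `X = ℙ¹`, `D = [0]+[1]+[∞]`:
such coverings are dominated by Kummer covers, and the field of definition of a point `y` of a
Kummer cover over `x ∈ U(K)` is `M = K(r)` with `r^e = a`, `a ∈ {x, 1−x, x(1−x), …}` a unit off the
conductor of `x`.

* `ndeg_differentDivisor_le_of_kummer_generator` — **for every number field `M = K(r)` with
  `r^e = a ∈ K^×`, `a` a unit outside the finite set `S` of primes of `K`:
  `deg(𝔡^M) ≤ deg(𝔡^K) + deg(𝔣^K_S) + 2·log(e²·e!)`**, i.e.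
  `(1/[M:ℚ]) log|d_M| ≤ (1/[K:ℚ]) log|d_K| + (1/[K:ℚ]) Σ_{v∈S} log N(v) + 2 log(e²·e!)` — by passing to
  the Galois closure `L = M(ζ_e)` = the splitting field of `X^e − a` over `K` (generated over `K` by
  the roots of `X^e − a`, all radicals of the unit `a`; `[L:K] ≤ e·e!`) and
  `ndeg_differentDivisor_le_of_adjoin_radicals_tower` (`GenEllRadicalCoverDifferent`).
* `sum_primeFactors_log_le` — the bookkeeping `Σ_{p ∣ D·N} (v_p(N)+1) log p ≤ 2 log(D·N)`.

Theorems only; no definitions, no named facts.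
-/

noncomputable section

open NumberField IsDedekindDomain Finset Polynomial
open Literature.IUT.LogVolume

namespace Literature.NumberTheory.DiophantineGeometry.GenEll

/-! ## Arithmetic of the constant -/

/-- `Σ_{p ∣ D·N} (v_p(N) + 1)·log p ≤ 2·log(D·N)`: `Σ_p v_p(N) log p = log N` and
`Σ_{p ∣ D N} log p = log rad(D N) ≤ log(D N)`. [folklore] -/
private theorem sum_primeFactors_log_le {D N : ℕ} (hD : D ≠ 0) (hN : N ≠ 0) :
    ∑ p ∈ (D * N).primeFactors, (((N.factorization p + 1 : ℕ) : ℝ)) * Real.log p ≤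
      2 * Real.log ((D * N : ℕ) : ℝ) := by
  have hDN : D * N ≠ 0 := mul_ne_zero hD hN
  have hsplit : ∑ p ∈ (D * N).primeFactors, (((N.factorization p + 1 : ℕ) : ℝ)) * Real.log p =
      ∑ p ∈ (D * N).primeFactors, (N.factorization p : ℝ) * Real.log p +
        ∑ p ∈ (D * N).primeFactors, Real.log p := by
    rw [← Finset.sum_add_distrib]
    refine Finset.sum_congr rfl fun p _ => ?_
    push_cast
    ring
  -- `Σ_{p ∣ DN} v_p(N) log p = Σ_{p ∣ N} v_p(N) log p = log N`
  have h1 : ∑ p ∈ (D * N).primeFactors, (N.factorization p : ℝ) * Real.log p = Real.log N := by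
    have hsub : N.primeFactors ⊆ (D * N).primeFactors :=
      Nat.primeFactors_mono (dvd_mul_left N D) hDN
    rw [← Finset.sum_subset hsub (fun p _ hp => by
      rw [← Nat.support_factorization, Finsupp.notMem_support_iff] at hp
      simp [hp])]
    have hprod : ((N.factorization.prod fun p k => p ^ k : ℕ) : ℝ) = N := by
      rw [Nat.prod_factorization_pow_eq_self hN]
    rw [← hprod, Finsupp.prod, Nat.support_factorization, Nat.cast_prod,
      Real.log_prod (s := N.primeFactors) (f := fun p => ((p ^ N.factorization p : ℕ) : ℝ)) (fun p hp => by
        have : 0 < p := (Nat.prime_of_mem_primeFactors hp).pos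
        positivity)]
    refine Finset.sum_congr rfl fun p _ => ?_
    rw [Nat.cast_pow, Real.log_pow]
  -- `Σ_{p ∣ DN} log p = log ∏ p ≤ log (DN)`
  have h2 : ∑ p ∈ (D * N).primeFactors, Real.log p ≤ Real.log ((D * N : ℕ) : ℝ) := by
    rw [← Real.log_prod (fun p hp => by
      have : 0 < p := (Nat.prime_of_mem_primeFactors hp).pos
      exact_mod_cast this.ne')]
    refine Real.log_le_log ?_ ?_
    · exact Finset.prod_pos fun p hp => by exact_mod_cast (Nat.prime_of_mem_primeFactors hp).pos
    · rw [← Nat.cast_prod]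
      exact_mod_cast Nat.le_of_dvd (Nat.pos_of_ne_zero hDN) (Nat.prod_primeFactors_dvd (D * N))
  have h3 : Real.log (N : ℝ) ≤ Real.log ((D * N : ℕ) : ℝ) := by
    refine Real.log_le_log (by exact_mod_cast Nat.pos_of_ne_zero hN) ?_
    exact_mod_cast Nat.le_mul_of_pos_left N (Nat.pos_of_ne_zero hD)
  rw [hsplit, h1]
  linarith

/-! ## The splitting field of `X^e − a` over an intermediate radical field -/

variable (K M : Type*) [Field K] [NumberField K] [Field M] [NumberField M] [Algebra K M]

/-- **[GenEll] Prop. 1.7 (i), right inequality, for `M = K(a^{1/e})`** (the field of definition of a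
point of a Kummer cover of `ℙ¹ ∖ {0,1,∞}` over `x ∈ U(K)`, `a` a monomial in `x, 1−x`): if `a ∈ K^×`
is a unit at every prime outside the finite set `S`, `1 ≤ e`, `r ∈ M` with `r^e = a` and `M = K(r)`,
then `deg(𝔡^M) ≤ deg(𝔡^K) + deg(𝔣^K_S) + 2·log(e²·e!)` (normalised log-different and log-conductor of
the tree's `IdealArithmeticDivisors`; constant uniform in `K`, `a`, `M`). Proof: the splitting field
`L ⊇ M` of `X^e − a` is Galois over `K`, generated by radicals of `a`, of degree `≤ e·e!`; apply
`ndeg_differentDivisor_le_of_adjoin_radicals_tower`. [cite: MochizukiGenEll2010, Prop 1.7 (i) p.9] -/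
theorem ndeg_differentDivisor_le_of_kummer_generator (S : Finset (HeightOneSpectrum (𝓞 K)))
    {a : K} (ha : a ≠ 0) (hunit : ∀ v : HeightOneSpectrum (𝓞 K), v ∉ S → v.valuation K a = 1)
    {e : ℕ} (he : 0 < e) {r : M} (hr : r ^ e = algebraMap K M a)
    (hgen : IntermediateField.adjoin K {r} = ⊤) :
    ndeg M (differentDivisor M) ≤ ndeg K (differentDivisor K) + ndeg K (ADivisor.reduced S) +
      2 * Real.log ((e * (e * e.factorial) : ℕ) : ℝ) := by
  classical
  -- the polynomial `X^e − a` and its splitting field over `M`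
  set p : K[X] := X ^ e - C a with hp
  have he0 : e ≠ 0 := he.ne'
  have hp0 : p ≠ 0 := X_pow_sub_C_ne_zero he a
  have hpdeg : p.natDegree = e := natDegree_X_pow_sub_C
  have hpsep : p.Separable := separable_X_pow_sub_C a (by exact_mod_cast he0) ha
  set f : M[X] := p.map (algebraMap K M) with hf
  let L := f.SplittingField
  haveI : FiniteDimensional ℚ L := Module.Finite.trans M L
  haveI : NumberField L := NumberField.mk
  -- `L` is a splitting field of `p` over `K`
  have hmapKL : p.map (algebraMap K L) = f.map (algebraMap M L) := by
    change p.map (algebraMap K L) = (p.map (algebraMap K M)).map (algebraMap M L)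
    rw [Polynomial.map_map, ← IsScalarTower.algebraMap_eq]
  have hsplits : (p.map (algebraMap K L)).Splits := by
    rw [hmapKL]; exact SplittingField.splits f
  have hrootSet : p.rootSet L = f.rootSet L := by
    rw [rootSet, rootSet, aroots, aroots, hmapKL]
  have hrint : IsIntegral K r := IsIntegral.of_pow he (by rw [hr]; exact isIntegral_algebraMap)
  have hrL : algebraMap M L r ∈ p.rootSet L := by
    rw [mem_rootSet]
    refine ⟨hp0, ?_⟩
    rw [hp, map_sub, map_pow, aeval_X, aeval_C, ← map_pow, hr, ← IsScalarTower.algebraMap_apply,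
      sub_self]
  have hrange : ∀ m : M, algebraMap M L m ∈ Algebra.adjoin K (p.rootSet L) := by
    intro m
    have hm : m ∈ (IntermediateField.adjoin K ({r} : Set M)).toSubalgebra := by
      rw [hgen]; trivial
    rw [IntermediateField.adjoin_simple_toSubalgebra_of_isAlgebraic hrint.isAlgebraic] at hm
    have hmap : (Algebra.adjoin K ({r} : Set M)).map (IsScalarTower.toAlgHom K M L) ≤
        Algebra.adjoin K (p.rootSet L) := by
      rw [AlgHom.map_adjoin]
      refine Algebra.adjoin_mono ?_
      rintro _ ⟨y, rfl : y = r, rfl⟩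
      exact hrL
    exact hmap ⟨m, hm, rfl⟩
  have hadj : Algebra.adjoin K (p.rootSet L) = ⊤ := by
    -- the `K`-algebra generated by the roots contains `M` and the roots, hence the `M`-algebra
    -- generated by the roots, which is everything
    let A : Subalgebra M L :=
      { carrier := Algebra.adjoin K (p.rootSet L)
        mul_mem' := fun hx hy => Subalgebra.mul_mem _ hx hy
        add_mem' := fun hx hy => Subalgebra.add_mem _ hx hy
        algebraMap_mem' := fun m => hrange m }
    have hA : Algebra.adjoin M (f.rootSet L) ≤ A := Algebra.adjoin_le fun x hx => by
      change x ∈ Algebra.adjoin K (p.rootSet L)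
      rw [hrootSet]
      exact Algebra.subset_adjoin hx
    rw [SplittingField.adjoin_rootSet f] at hA
    rw [eq_top_iff]
    intro x _
    exact hA Algebra.mem_top
  haveI hIsSplit : p.IsSplittingField K L := ⟨hsplits, hadj⟩
  haveI : IsGalois K L := IsGalois.of_separable_splitting_field hpsep
  -- radical generators: the roots of `X^e − a`
  have hG : IntermediateField.adjoin K (p.rootSet L) = ⊤ := by
    rw [eq_top_iff]
    intro x _
    exact IntermediateField.algebra_adjoin_le_adjoin K _ (hadj.symm ▸ Algebra.mem_top)
  have hrad : ∀ α ∈ p.rootSet L, ∃ (d : ℕ) (a' : K), d ≠ 0 ∧ d ∣ e ∧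
      (∀ v : HeightOneSpectrum (𝓞 K), v ∉ S → v.valuation K a' = 1) ∧ α ^ d = algebraMap K L a' := by
    intro α hα
    refine ⟨e, a, he0, dvd_rfl, hunit, ?_⟩
    rw [mem_rootSet] at hα
    have h := hα.2
    rw [hp, map_sub, map_pow, aeval_X, aeval_C, sub_eq_zero] at h
    exact h
  have hmain := ndeg_differentDivisor_le_of_adjoin_radicals_tower K L M S hG he0 hrad
  -- degree bound `[L:K] ≤ e · e!`
  have hKM : Module.finrank K M ≤ e := by
    have h1 : Module.finrank K (IntermediateField.adjoin K ({r} : Set M)) = (minpoly K r).natDegree :=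
      IntermediateField.adjoin.finrank hrint
    rw [hgen, IntermediateField.finrank_top'] at h1
    rw [h1, ← hpdeg]
    exact natDegree_le_of_dvd (minpoly.dvd K r (by
      rw [hp, map_sub, map_pow, aeval_X, aeval_C, hr, sub_self])) hp0
  have hML : Module.finrank M L ≤ e.factorial := by
    have hfsep : f.Separable := hpsep.map
    have hcard : Nat.card f.Gal = Module.finrank M L := Gal.card_of_separable hfsep
    haveI : Fact ((f.map (algebraMap M L)).Splits) := ⟨SplittingField.splits f⟩
    have hinj := Gal.galActionHom_injective f L
    have h1 : Nat.card f.Gal ≤ Nat.card (Equiv.Perm (f.rootSet L)) :=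
      Nat.card_le_card_of_injective _ hinj
    rw [Nat.card_perm] at h1
    have h2 : Nat.card (f.rootSet L) ≤ e := by
      rw [Nat.card_coe_set_eq, rootSet_def, Set.ncard_coe_finset]
      calc (f.aroots L).toFinset.card ≤ Multiset.card (f.aroots L) := Multiset.toFinset_card_le _
        _ ≤ (f.map (algebraMap M L)).natDegree := card_roots' _
        _ = e := by rw [← hmapKL, natDegree_map, hpdeg]
    rw [← hcard]
    exact h1.trans (Nat.factorial_le h2)
  have hN : Module.finrank K L ≤ e * e.factorial := by
    rw [← Module.finrank_mul_finrank K M L]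
    exact Nat.mul_le_mul hKM hML
  have hN0 : Module.finrank K L ≠ 0 := Module.finrank_pos.ne'
  -- the constant
  have hconst := sum_primeFactors_log_le (D := e) (N := Module.finrank K L) he0 hN0
  have hmono : 2 * Real.log ((e * Module.finrank K L : ℕ) : ℝ) ≤
      2 * Real.log ((e * (e * e.factorial) : ℕ) : ℝ) := by
    refine mul_le_mul_of_nonneg_left (Real.log_le_log ?_ ?_) (by norm_num)
    · exact_mod_cast Nat.mul_pos he (Nat.pos_of_ne_zero hN0)
    · exact_mod_cast Nat.mul_le_mul_left e hN
  linarith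

/-- **Log-discriminant form**: under the hypotheses of `ndeg_differentDivisor_le_of_kummer_generator`,
`(1/[M:ℚ]) log|d_M| ≤ (1/[K:ℚ]) log|d_K| + (1/[K:ℚ]) log ∏_{v∈S} N(v) + 2 log(e²·e!)`.
[cite: MochizukiGenEll2010, Prop 1.7 (i) p.9] -/
theorem logdisc_le_of_kummer_generator (S : Finset (HeightOneSpectrum (𝓞 K)))
    {a : K} (ha : a ≠ 0) (hunit : ∀ v : HeightOneSpectrum (𝓞 K), v ∉ S → v.valuation K a = 1)
    {e : ℕ} (he : 0 < e) {r : M} (hr : r ^ e = algebraMap K M a)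
    (hgen : IntermediateField.adjoin K {r} = ⊤) :
    Real.log ((NumberField.discr M).natAbs) / Module.finrank ℚ M ≤
      Real.log ((NumberField.discr K).natAbs) / Module.finrank ℚ K +
      Real.log ((∏ v ∈ S, Ideal.absNorm v.asIdeal : ℕ) : ℝ) / Module.finrank ℚ K +
      2 * Real.log ((e * (e * e.factorial) : ℕ) : ℝ) := by
  have h := ndeg_differentDivisor_le_of_kummer_generator K M S ha hunit he hr hgen
  rwa [ndeg_apply, ndeg_apply, ndeg_apply, degF_differentDivisor, degF_differentDivisor,
    ADivisor.degF_reduced] at h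

/-! ## Point form: the Kummer cover `r^e = x(1−x)` of `ℙ¹ ∖ {0,1,∞}` -/

/-- Off the support of the conductor of `x` (the primes where `x` meets `0, 1, ∞`), both `x` and
`1 − x` are units. [cite: MochizukiGenEll2010, Def 1.5 (iv) p.8] -/
theorem NFPoint.valuation_eq_one_of_not_mem_condSupport (P : NFPoint)
    {v : HeightOneSpectrum (𝓞 P.F)} (hv : v ∉ P.condSupport) :
    v.valuation P.F P.x = 1 ∧ v.valuation P.F (1 - P.x) = 1 := by
  simp only [NFPoint.condSupport, Set.mem_setOf_eq, not_or, not_lt] at hv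
  obtain ⟨h1, h2, h3⟩ := hv
  have hx : v.valuation P.F P.x = 1 := le_antisymm h2 h1
  refine ⟨hx, le_antisymm ?_ ?_⟩
  · calc v.valuation P.F (1 - P.x) ≤ max (v.valuation P.F 1) (v.valuation P.F P.x) :=
        Valuation.map_sub _ _ _
      _ = 1 := by rw [map_one, hx, max_self]
  · rw [Valuation.map_sub_swap]; exact h3

/-- **[GenEll] Prop. 1.7 (i), right inequality, for the Kummer cover `D_e : r^e = x(1−x)` of
`ℙ¹ ∖ {0,1,∞}`, point form**: for `x ∈ U_P(F)` presented over `F` and a point `(x, r)` of the cover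
presented over `M = F(r)` (`r^e = x(1−x)`), `log-diff(M) ≤ log-diff(F) + log-cond_{[0]+[1]+[∞]}(x) + 2 log(e²·e!)`
— the cover is étale over `U_P`, so its ramification is absorbed by the conductor of `x` (tame part,
Dedekind) up to a constant depending only on `e` (wild part over `p ∣ e·[L:F]`). In the tree's
vocabulary: `Q.logDiff ≤ P.logDiff + P.logCond + 2·log(e²·e!)`. [cite: MochizukiGenEll2010, Prop 1.7 (i) p.9] -/
theorem NFPoint.logDiff_le_of_kummer_generator (P Q : NFPoint) [Algebra P.F Q.F] (hP : P.InU)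
    {e : ℕ} (he : 0 < e) {r : Q.F} (hr : r ^ e = algebraMap P.F Q.F (P.x * (1 - P.x)))
    (hgen : IntermediateField.adjoin P.F {r} = ⊤) :
    Q.logDiff ≤ P.logDiff + P.logCond + 2 * Real.log ((e * (e * e.factorial) : ℕ) : ℝ) := by
  have ha : P.x * (1 - P.x) ≠ 0 := mul_ne_zero hP.1 (sub_ne_zero.mpr (Ne.symm hP.2))
  have hunit : ∀ v : HeightOneSpectrum (𝓞 P.F), v ∉ (P.condSupport_finite hP).toFinset →
      v.valuation P.F (P.x * (1 - P.x)) = 1 := by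
    intro v hv
    rw [Set.Finite.mem_toFinset] at hv
    obtain ⟨h1, h2⟩ := P.valuation_eq_one_of_not_mem_condSupport hv
    rw [map_mul, h1, h2, one_mul]
  rw [logDiff_eq_ndeg_differentDivisor, logDiff_eq_ndeg_differentDivisor,
    logCond_eq_ndeg_condDivisor P hP, condDivisor]
  exact ndeg_differentDivisor_le_of_kummer_generator P.F Q.F _ ha hunit he hr hgen

end Literature.NumberTheory.DiophantineGeometry.GenEll

end
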